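import Summits.BirchSwinnertonDyer.Rank1Residual.GaloisImage.GroupRingPrimitiveProjector
import Summits.BirchSwinnertonDyer.Rank1Residual.GaloisImage.MazurTateCharacterComponents
import Mathlib.RingTheory.IntegralDomain
import Mathlib.GroupTheory.Index
import HarnessLib

/-!
# Character components at a square-free level: norm elements, Fourier synthesis, and the
# pull-backs of the Mazur–Tate elements `θ̃_f(n_d)` to `ℂ[(ℤ/n)ˣ]`
# (cell `b2b-bsdres`, team n1011, ROUTE-1 PORT anatomy (P-KIM); R1-71/R1-72: PK-4b
# `KatoZetaValueDerivativeCongruence`, layer PK-4b-C4a — the modular side; seat p15 GEN 9)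

HONEST FRAMING (cell `b2b-bsdres`, run/shared/lean/b2b/bsd-rank1-residual/, verbatim in every
file): the goal of the cell is to DELETE the COMBINATION-SHAPED residual classes of the
Birch–Swinnerton-Dyer formula for ALL analytic-rank `≤ 1` elliptic curves over `ℚ` — "full BSD
formula for every rank `≤ 1` curve in class `C`" assembled STRICTLY from published theorems — so
that the rank-`≤ 1` remainder becomes exactly the CONSTRUCTION-SHAPED classes, which are TYPED
(missing-input `Prop`s), NOT attempted. This is not "finishing BSD". Team n1011 (N10/N11; ROUTE 1,
the PORT anatomy (P-KIM) of class X4 ∧ `p = 3`): research route on CONSTRUCTION-SHAPED classes;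
prove what is provable now; no claim beyond stated classes; census output = EVIDENCE, never a
Literature fact; RESIDUAL-MAP marks UNCHANGED; nothing is booked by this file. TOOL THEOREMS ONLY:
no definition, no named fact, no instance, no `sorry`.

## What

`n = ∏_i ℓ_i` a product of distinct primes (`ι` finite), `G = (ℤ/n)ˣ`, levels `d : Finset ι` with
`n_d = ∏_{i∈d} ℓ_i ∣ n` and `K_d = ker((ℤ/n)ˣ → (ℤ/n_d)ˣ)`. For PK-4b-C3's hypothesis `hY` we need the
CHARACTER COMPONENTS `χ(Z) = lift χ Z` of: the norm elements `N_{K_d}` (`= #K_d` or `0` according as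
the conductor of `χ` divides `n_d`, with `#K_d · φ(n_d) = φ(n)` — §2, on top of PK-4b-C1), the
pull-back `Θ_d = Σ_g [π_d(g)/n_d]⁺_f δ_g` of `θ̃_f(n_d)` (`= N_{K_d} · Σ_h [h/n_d]⁺ δ_{s(h)}` for any
section `s`, hence `χ(Θ_d) = [cond χ ∣ n_d] · #K_d · Σ_{h∈(ℤ/n_d)ˣ} [h/n_d]⁺ χ_d(h)` — §3), and the
level-`n_d` character sums of `θ̃` pushed down to the conductor: for `χ_d` induced from `χ₀` mod
`n₀ ∣ n_d`, `Σ_h [h/n_d]⁺ χ_d(h) = (∏_{ℓ ∣ n_d/n₀} (a_ℓ − χ₀(ℓ) − χ₀⁻¹(ℓ))) · Σ_{a∈(ℤ/n₀)ˣ} [a/n₀]⁺ χ₀(a)`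
(§4: F-C `CharComponent.sum_changeLevel_mul_ratPlusSymbol` ITERATED over the primes of `n_d/n₀`).
§1 is Fourier SYNTHESIS on `ℂ[(ℤ/n)ˣ]`: every function of the Dirichlet characters mod `n` is the
component function of some element (`exists_forall_lift_eq`) — used by PK-4b-C4b to name the
primitive datum `B`. Also the divisor arithmetic of the levels (`dvd_prod_iff_forall_not_dvd`, …).
HONEST LIMITS: bookkeeping only; the Hecke input is F-C's (`IsNewform0 f`, `coeffField f = ⊥`,
`a_ℓ = cuspCoeff f ℓ ∈ ℤ`, `ℓ ∤ N`); no Kato object; closes nothing.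

References: B. Mazur, J. Tate, Duke Math. J. 54 (1987) §1; K. Ota, arXiv:1509.00682 Prop. 2.3 (1);
M. Kurihara, arXiv:1407.2465 §1.1;
r1 ROUTE-1 §55–57 (cells/n1011/ROUTE-1.md).
-/

noncomputable section

namespace Summit.BirchSwinnertonDyer.Rank1Residual.GaloisImage

namespace EulerFactorComparison

open Finset MonoidAlgebra
open scoped BigOperators
open Literature.NumberTheory.EllipticCurves Literature.NumberTheory.EllipticCurves.ModularForms
open Literature.NumberTheory.EllipticCurves.MazurTate
open CongruenceSubgroup

/-! ### §1 Fourier synthesis on `ℂ[(ℤ/n)ˣ]` -/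

section Synthesis

variable (n : ℕ) [NeZero n]

/-- Dual orthogonality on the units: `Σ_{g∈(ℤ/n)ˣ} χ⁻¹(g) ψ(g) = φ(n)` if `χ = ψ`, else `0`. [folklore] -/
theorem sum_units_inv_mul_apply (χ ψ : DirichletCharacter ℂ n) :
    ∑ g : (ZMod n)ˣ, χ⁻¹ (g : ZMod n) * ψ (g : ZMod n) = if χ = ψ then (n.totient : ℂ) else 0 := by
  by_cases h : χ = ψ
  · subst h
    rw [if_pos rfl]
    have h1 : ∀ g : (ZMod n)ˣ, χ⁻¹ (g : ZMod n) * χ (g : ZMod n) = 1 := fun g => by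
      rw [← MulChar.mul_apply, inv_mul_cancel, MulChar.one_apply (Units.isUnit g)]
    simp_rw [h1]
    rw [Finset.sum_const, Finset.card_univ, ZMod.card_units_eq_totient, nsmul_eq_mul, mul_one]
  · rw [if_neg h]
    have hf : (Units.coeHom ℂ).comp (χ⁻¹ * ψ).toUnitHom ≠ 1 := by
      intro h1
      apply h
      refine (MulChar.ext fun g => ?_).symm
      have hg := DFunLike.congr_fun h1 g
      rw [MonoidHom.comp_apply, Units.coeHom_apply, MulChar.coe_toUnitHom, MonoidHom.one_apply,
        MulChar.mul_apply, CharSum.inv_apply_coe_units] at hg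
      -- `χ(g⁻¹) ψ(g) = 1` and `χ(g⁻¹) χ(g) = 1`
      have hχ : χ ((g : ZMod n)⁻¹) * χ (g : ZMod n) = 1 := by
        rw [← map_mul, ZMod.inv_mul_of_unit _ (Units.isUnit g), map_one]
      have hne : χ ((g : ZMod n)⁻¹) ≠ 0 := fun h0 => by rw [h0, zero_mul] at hχ; exact zero_ne_one hχ
      exact mul_left_cancel₀ hne (hg.trans hχ.symm)
    have hsum := sum_hom_units_eq_zero _ hf
    rw [← hsum]
    refine Finset.sum_congr rfl fun g _ => ?_
    rw [MonoidHom.comp_apply, Units.coeHom_apply, MulChar.coe_toUnitHom, MulChar.mul_apply]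

/-- **Fourier synthesis**: every function of the Dirichlet characters mod `n` is the component
function `ψ ↦ lift ψ Z` of an element `Z ∈ ℂ[(ℤ/n)ˣ]` (namely
`Z = Σ_g (φ(n)⁻¹ Σ_χ F(χ) χ⁻¹(g)) δ_g`). [folklore] -/
theorem exists_forall_lift_eq (F : DirichletCharacter ℂ n → ℂ) :
    ∃ Z : MonoidAlgebra ℂ (ZMod n)ˣ, ∀ ψ : DirichletCharacter ℂ n,
      MonoidAlgebra.lift ℂ ℂ (ZMod n)ˣ ((Units.coeHom ℂ).comp ψ.toUnitHom) Z = F ψ := by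
  refine ⟨∑ χ : DirichletCharacter ℂ n, ∑ g : (ZMod n)ˣ,
    single g ((n.totient : ℂ)⁻¹ * F χ * χ⁻¹ (g : ZMod n)), fun ψ => ?_⟩
  have hφ : (n.totient : ℂ) ≠ 0 := by exact_mod_cast (Nat.totient_pos.mpr (NeZero.pos n)).ne'
  simp_rw [map_sum, lift_single_coeHom]
  have hinner : ∀ χ : DirichletCharacter ℂ n,
      ∑ g : (ZMod n)ˣ, (n.totient : ℂ)⁻¹ * F χ * χ⁻¹ (g : ZMod n) * ψ (g : ZMod n) =
        (n.totient : ℂ)⁻¹ * F χ * (if χ = ψ then (n.totient : ℂ) else 0) := by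
    intro χ
    rw [← sum_units_inv_mul_apply n χ ψ, Finset.mul_sum]
    exact Finset.sum_congr rfl fun g _ => by ring
  rw [Finset.sum_congr rfl fun χ _ => hinner χ, Finset.sum_eq_single ψ
    (fun χ _ hne => by rw [if_neg hne, mul_zero]) (fun h => absurd (Finset.mem_univ ψ) h),
    if_pos rfl, mul_right_comm, inv_mul_cancel₀ hφ, one_mul]

end Synthesis

/-! ### §2 Square-free levels: divisors, kernels, norm components -/

section Levels

variable {ι : Type*} [Fintype ι] [DecidableEq ι] (ℓ : ι → ℕ) [hℓ : ∀ i, Fact (ℓ i).Prime]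
  (hinj : Function.Injective ℓ) {n : ℕ} [NeZero n] (hn : ∏ i, ℓ i = n)

omit [DecidableEq ι] hℓ [NeZero n] in
include hn in
/-- `n_d = ∏_{i∈d} ℓ_i` divides `n`. [folklore] -/
theorem prod_dvd_of_prod_eq (d : Finset ι) : (∏ i ∈ d, ℓ i) ∣ n :=
  hn ▸ Finset.prod_dvd_prod_of_subset _ _ _ (Finset.subset_univ d)

omit hℓ [NeZero n] in
include hn in
/-- `n = n_d · ∏_{j∉d} ℓ_j`. [folklore] -/
theorem prod_mul_prod_compl_eq (d : Finset ι) : (∏ i ∈ d, ℓ i) * ∏ j ∈ univ \ d, ℓ j = n := by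
  rw [mul_comm, Finset.prod_sdiff (Finset.subset_univ d), hn]

omit [Fintype ι] [DecidableEq ι] in
include hinj in
/-- A prime `ℓ_j` divides `n_d` iff `j ∈ d`. [folklore] -/
theorem dvd_prod_iff_mem {d : Finset ι} {j : ι} : ℓ j ∣ ∏ i ∈ d, ℓ i ↔ j ∈ d := by
  constructor
  · intro h
    obtain ⟨i, hi, hji⟩ := (Prime.dvd_finsetProd_iff (hℓ j).out.prime _).mp h
    rwa [hinj ((Nat.prime_dvd_prime_iff_eq (hℓ j).out (hℓ i).out).mp hji)]
  · intro hj
    exact Finset.dvd_prod_of_mem _ hj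

omit [NeZero n] in
include hinj hn in
/-- For `c ∣ n`: `c ∣ n_d` iff no `ℓ_j`, `j ∉ d`, divides `c`. [folklore] -/
theorem dvd_prod_iff_forall_not_dvd {c : ℕ} (hc : c ∣ n) (d : Finset ι) :
    c ∣ ∏ i ∈ d, ℓ i ↔ ∀ j, j ∉ d → ¬ ℓ j ∣ c := by
  constructor
  · intro h j hj hjc
    exact hj ((dvd_prod_iff_mem ℓ hinj).mp (hjc.trans h))
  · intro h
    have hcop : Nat.Coprime c (∏ j ∈ univ \ d, ℓ j) :=
      Nat.Coprime.prod_right fun j hj =>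
        ((Nat.Prime.coprime_iff_not_dvd (hℓ j).out).mpr (h j (Finset.mem_sdiff.mp hj).2)).symm
    rw [← prod_mul_prod_compl_eq ℓ hn d] at hc
    exact hcop.dvd_of_dvd_mul_right hc

omit [NeZero n] in
include hinj hn in
/-- In particular (`d = univ ∖ {j}`): `c ∣ n/ℓ_j = ∏_{i≠j} ℓ_i` iff `ℓ_j ∤ c`, for `c ∣ n`. [folklore] -/
theorem dvd_prod_erase_iff_not_dvd {c : ℕ} (hc : c ∣ n) (j : ι) :
    c ∣ ∏ i ∈ univ.erase j, ℓ i ↔ ¬ ℓ j ∣ c := by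
  rw [dvd_prod_iff_forall_not_dvd ℓ hinj hn hc]
  simp only [Finset.mem_erase, Finset.mem_univ, and_true, not_not]
  exact ⟨fun h => h j rfl, fun h i hi => hi ▸ h⟩

omit [NeZero n] in
include hinj hn in
/-- Hence `c ∣ n_d` iff `c ∣ ∏_{i≠j} ℓ_i` for every `j ∉ d` (`c ∣ n`). [folklore] -/
theorem dvd_prod_iff_forall_dvd_prod_erase {c : ℕ} (hc : c ∣ n) (d : Finset ι) :
    c ∣ ∏ i ∈ d, ℓ i ↔ ∀ j, j ∉ d → c ∣ ∏ i ∈ univ.erase j, ℓ i := by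
  rw [dvd_prod_iff_forall_not_dvd ℓ hinj hn hc]
  exact forall₂_congr fun j _ => (dvd_prod_erase_iff_not_dvd ℓ hinj hn hc j).symm

omit [Fintype ι] in
include hinj in
/-- `φ(∏_{i∈d} ℓ_i) = ∏_{i∈d} (ℓ_i − 1)` for distinct primes. [folklore] -/
theorem totient_prod_eq (d : Finset ι) : (∏ i ∈ d, ℓ i).totient = ∏ i ∈ d, (ℓ i - 1) := by
  induction d using Finset.induction_on with
  | empty => simp
  | insert j d hj ih =>
    rw [Finset.prod_insert hj, Finset.prod_insert hj, Nat.totient_mul, Nat.totient_prime (hℓ j).out, ih]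
    exact Nat.Coprime.prod_right fun i hi =>
      (Nat.coprime_primes (hℓ j).out (hℓ i).out).mpr fun h => hj (hinj h ▸ hi)

omit [DecidableEq ι] hℓ in
/-- `#ker((ℤ/n)ˣ → (ℤ/m)ˣ) · φ(m) = φ(n)` for `m ∣ n` (the reduction map is onto). [folklore] -/
theorem card_ker_unitsMap_mul_totient {m : ℕ} [NeZero m] (hm : m ∣ n) :
    (univ.filter (· ∈ (ZMod.unitsMap hm).ker)).card * m.totient = n.totient := by
  classical
  have h1 : (univ.filter (· ∈ (ZMod.unitsMap hm).ker)).card = Nat.card (ZMod.unitsMap hm).ker := by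
    rw [Nat.card_eq_fintype_card, Fintype.card_subtype]
  have h2 : (ZMod.unitsMap hm).ker.index = m.totient := by
    rw [Subgroup.index_ker, MonoidHom.range_eq_top.mpr (ZMod.unitsMap_surjective hm), Subgroup.card_top,
      Nat.card_eq_fintype_card, ZMod.card_units_eq_totient]
  rw [h1, ← h2, Subgroup.card_mul_index, Nat.card_eq_fintype_card, ZMod.card_units_eq_totient]

include hinj hn in
/-- `#K_d = ∏_{j∉d} (ℓ_j − 1)` for `K_d = ker((ℤ/n)ˣ → (ℤ/n_d)ˣ)`. [folklore] -/
theorem card_ker_unitsMap_prod (d : Finset ι) :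
    haveI : NeZero (∏ i ∈ d, ℓ i) := ⟨Finset.prod_ne_zero_iff.mpr fun i _ => (hℓ i).out.ne_zero⟩
    (univ.filter (· ∈ (ZMod.unitsMap (prod_dvd_of_prod_eq ℓ hn d)).ker)).card =
      ∏ j ∈ univ \ d, (ℓ j - 1) := by
  haveI : NeZero (∏ i ∈ d, ℓ i) := ⟨Finset.prod_ne_zero_iff.mpr fun i _ => (hℓ i).out.ne_zero⟩
  have h := card_ker_unitsMap_mul_totient (n := n) (prod_dvd_of_prod_eq ℓ hn d)
  have hφ : n.totient = (∏ i ∈ d, (ℓ i - 1)) * ∏ j ∈ univ \ d, (ℓ j - 1) := by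
    rw [← hn, totient_prod_eq ℓ hinj, ← Finset.prod_sdiff (Finset.subset_univ d), mul_comm]
  rw [totient_prod_eq ℓ hinj, hφ] at h
  have hpos : 0 < ∏ i ∈ d, (ℓ i - 1) :=
    Finset.prod_pos fun i _ => Nat.sub_pos_of_lt (hℓ i).out.one_lt
  exact Nat.eq_of_mul_eq_mul_right hpos (by rw [h, mul_comm])

/-- **Components of a kernel norm.** For `m ∣ n` and `K = ker((ℤ/n)ˣ → (ℤ/m)ˣ)`:
`lift χ N_K = #K` if `cond χ ∣ m`, and `= 0` otherwise. [folklore] -/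
theorem lift_sum_single_ker_eq {m : ℕ} (hm : m ∣ n) (χ : DirichletCharacter ℂ n) :
    MonoidAlgebra.lift ℂ ℂ (ZMod n)ˣ ((Units.coeHom ℂ).comp χ.toUnitHom)
        (∑ h ∈ univ.filter (· ∈ (ZMod.unitsMap hm).ker), single h (1 : ℂ)) =
      if χ.conductor ∣ m then (((univ.filter (· ∈ (ZMod.unitsMap hm).ker)).card : ℕ) : ℂ) else 0 := by
  by_cases hc : χ.conductor ∣ m
  · rw [if_pos hc]
    exact lift_sum_single_ker_of_factorsThrough n hm χ
      ((DirichletCharacter.mem_conductorSet_iff_conductor_dvd χ hm).mpr hc)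
  · rw [if_neg hc]
    exact lift_sum_single_ker_of_not_factorsThrough n hm χ
      (fun h => hc ((DirichletCharacter.mem_conductorSet_iff_conductor_dvd χ hm).mp h))

end Levels

/-! ### §3 Pull-backs along the reduction map: `Θ_d = N_{K_d} · (section image)` -/

section Pullback

variable {R : Type*} [CommRing R] {n m : ℕ} [NeZero n] [NeZero m] (hm : m ∣ n)

/-- **Pull-back = kernel norm × a section image.** For a section `s` of `π : (ℤ/n)ˣ → (ℤ/m)ˣ` and any
coefficients `F` on `(ℤ/m)ˣ`: `Σ_g F(π g) δ_g = N_{ker π} · Σ_h F(h) δ_{s(h)}`. [folklore] -/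
theorem sum_single_comp_unitsMap_eq (s : (ZMod m)ˣ → (ZMod n)ˣ) (hs : ∀ h, ZMod.unitsMap hm (s h) = h)
    (F : (ZMod m)ˣ → R) :
    ∑ g : (ZMod n)ˣ, single g (F (ZMod.unitsMap hm g)) =
      (∑ k ∈ univ.filter (· ∈ (ZMod.unitsMap hm).ker), single k (1 : R)) *
        ∑ h : (ZMod m)ˣ, single (s h) (F h) := by
  classical
  rw [Finset.mul_sum]
  have hterm : ∀ h : (ZMod m)ˣ,
      (∑ k ∈ univ.filter (· ∈ (ZMod.unitsMap hm).ker), single k (1 : R)) * single (s h) (F h) =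
        ∑ k ∈ univ.filter (· ∈ (ZMod.unitsMap hm).ker), single (s h * k) (F h) := by
    intro h
    rw [Finset.sum_mul]
    exact Finset.sum_congr rfl fun k _ => by rw [single_mul_single, one_mul, mul_comm]
  simp_rw [hterm]
  rw [Finset.sum_sigma' univ (fun _ => univ.filter (· ∈ (ZMod.unitsMap hm).ker))
    (fun h k => single (s h * k) (F h))]
  symm
  refine Finset.sum_nbij' (fun x => s x.1 * x.2) (fun g => ⟨ZMod.unitsMap hm g, (s (ZMod.unitsMap hm g))⁻¹ * g⟩)
    (fun x _ => Finset.mem_univ _) (fun g _ => ?_) (fun x hx => ?_) (fun g _ => ?_) (fun x hx => ?_)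
  · simp only [Finset.mem_sigma, Finset.mem_univ, Finset.mem_filter, true_and, MonoidHom.mem_ker,
      map_mul, map_inv, hs, inv_mul_cancel]
  · obtain ⟨h, k⟩ := x
    have hk : ZMod.unitsMap hm k = 1 := by
      have := (Finset.mem_sigma.mp hx).2
      simpa [Finset.mem_filter] using this
    have hπ : ZMod.unitsMap hm (s h * k) = h := by rw [map_mul, hs, hk, mul_one]
    simp only [hπ, inv_mul_cancel_left]
  · simp only [mul_inv_cancel_left]
  · obtain ⟨h, k⟩ := x
    have hk : ZMod.unitsMap hm k = 1 := by
      have := (Finset.mem_sigma.mp hx).2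
      simpa [Finset.mem_filter] using this
    simp only [map_mul, hs, hk, mul_one]

omit [NeZero m] in
/-- A section of the reduction map exists (it is onto). [folklore] -/
theorem exists_section_unitsMap : ∃ s : (ZMod m)ˣ → (ZMod n)ˣ, ∀ h, ZMod.unitsMap hm (s h) = h :=
  ⟨Function.surjInv (ZMod.unitsMap_surjective hm), Function.surjInv_eq (ZMod.unitsMap_surjective hm)⟩

/-- **Components of a pull-back.** For `χ` induced from `χ_m` mod `m`:
`lift χ (Σ_g F(π g) δ_g) = #ker π · Σ_h F(h) χ_m(h)`. [folklore] -/
theorem lift_sum_single_comp_unitsMap_of_changeLevel (F : (ZMod m)ˣ → ℂ) (χm : DirichletCharacter ℂ m) :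
    MonoidAlgebra.lift ℂ ℂ (ZMod n)ˣ
        ((Units.coeHom ℂ).comp (DirichletCharacter.changeLevel hm χm).toUnitHom)
        (∑ g : (ZMod n)ˣ, single g (F (ZMod.unitsMap hm g))) =
      (((univ.filter (· ∈ (ZMod.unitsMap hm).ker)).card : ℕ) : ℂ) *
        ∑ h : (ZMod m)ˣ, F h * χm (h : ZMod m) := by
  classical
  obtain ⟨s, hs⟩ := exists_section_unitsMap (n := n) hm
  rw [sum_single_comp_unitsMap_eq hm s hs F, map_mul,
    lift_sum_single_ker_of_factorsThrough n hm _ (DirichletCharacter.changeLevel_factorsThrough χm hm),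
    map_sum]
  congr 1
  refine Finset.sum_congr rfl fun h _ => ?_
  rw [lift_single_coeHom, DirichletCharacter.changeLevel_eq_cast_of_dvd χm hm (s h)]
  congr 1
  have : ((ZMod.unitsMap hm (s h) : (ZMod m)ˣ) : ZMod m) = ((s h : (ZMod n)ˣ) : ZMod n).cast := by
    rw [ZMod.unitsMap_def, Units.coe_map, MonoidHom.coe_coe, ZMod.castHom_apply]
  rw [← this, hs]

/-- **Components of a pull-back, general character**: `lift χ (Σ_g F(π g) δ_g) = 0` unless
`cond χ ∣ m`. [folklore] -/
theorem lift_sum_single_comp_unitsMap_eq_zero (F : (ZMod m)ˣ → ℂ) (χ : DirichletCharacter ℂ n)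
    (hχ : ¬ χ.conductor ∣ m) :
    MonoidAlgebra.lift ℂ ℂ (ZMod n)ˣ ((Units.coeHom ℂ).comp χ.toUnitHom)
        (∑ g : (ZMod n)ˣ, single g (F (ZMod.unitsMap hm g))) = 0 := by
  classical
  obtain ⟨s, hs⟩ := exists_section_unitsMap (n := n) hm
  rw [sum_single_comp_unitsMap_eq hm s hs F, map_mul,
    lift_sum_single_ker_of_not_factorsThrough n hm χ
      (fun h => hχ ((DirichletCharacter.mem_conductorSet_iff_conductor_dvd χ hm).mp h)), zero_mul]

end Pullback

/-! ### §4 The character sums of `θ̃_f` pushed down to the conductor (F-C iterated) -/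

section Hecke

variable {N : ℕ} [NeZero N] (f : CuspForm (Gamma0 N) 2)

omit [NeZero N] in
/-- Transport of the level-`m` character sum of `θ̃_f` along an equality of levels. [folklore] -/
theorem sum_units_changeLevel_congr {m₀ m₁ m₂ : ℕ} [NeZero m₁] [NeZero m₂] (h : m₁ = m₂)
    (h₁ : m₀ ∣ m₁) (h₂ : m₀ ∣ m₂) (χ₀ : DirichletCharacter ℂ m₀) :
    ∑ b : (ZMod m₁)ˣ, algebraMap ℚ ℂ (ratPlusSymbol f (((b : ZMod m₁).val : ℚ) / m₁)) *
        DirichletCharacter.changeLevel h₁ χ₀ (b : ZMod m₁) =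
      ∑ b : (ZMod m₂)ˣ, algebraMap ℚ ℂ (ratPlusSymbol f (((b : ZMod m₂).val : ℚ) / m₂)) *
        DirichletCharacter.changeLevel h₂ χ₀ (b : ZMod m₂) := by
  subst h
  rfl

/-- **`θ̃` character sums pushed down to an inducing level** (F-C iterated): for distinct primes
`ℓ_i ∤ N` (`i ∈ T`) not dividing `m₀`, `a_i = a_{ℓ_i}(f) ∈ ℤ`, and `χ₀` mod `m₀`, at the level
`m = m₀ · ∏_{i∈T} ℓ_i`:
`Σ_{b∈(ℤ/m)ˣ} [b/m]⁺ χ₀↑(b) = (∏_{i∈T} (a_i − χ₀(ℓ_i) − χ₀⁻¹(ℓ_i))) · Σ_{a∈(ℤ/m₀)ˣ} [a/m₀]⁺ χ₀(a)`.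
[cite: Ota2018, Prop. 2.3 (1)] -/
theorem sum_units_changeLevel_mul_ratPlusSymbol_prod (hf : IsNewform0 f) (hQ : coeffField f = ⊥)
    {ι : Type*} [DecidableEq ι] (ℓ : ι → ℕ) [hℓ : ∀ i, Fact (ℓ i).Prime] (hinj : Function.Injective ℓ)
    (hℓN : ∀ i, ¬ ℓ i ∣ N) (a : ι → ℤ) (ha : ∀ i, cuspCoeff f (ℓ i) = a i)
    {m₀ : ℕ} [NeZero m₀] (hm₀ : ∀ i, ¬ ℓ i ∣ m₀) (χ₀ : DirichletCharacter ℂ m₀) (T : Finset ι)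
    {m : ℕ} [NeZero m] (hm : m = m₀ * ∏ i ∈ T, ℓ i) (hdvd : m₀ ∣ m) :
    ∑ b : (ZMod m)ˣ, algebraMap ℚ ℂ (ratPlusSymbol f (((b : ZMod m).val : ℚ) / m)) *
        DirichletCharacter.changeLevel hdvd χ₀ (b : ZMod m) =
      (∏ i ∈ T, (algebraMap ℚ ℂ (a i) - χ₀ (ℓ i : ZMod m₀) - χ₀⁻¹ (ℓ i : ZMod m₀))) *
        ∑ b : (ZMod m₀)ˣ, algebraMap ℚ ℂ (ratPlusSymbol f (((b : ZMod m₀).val : ℚ) / m₀)) *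
          χ₀ (b : ZMod m₀) := by
  induction T using Finset.induction_on generalizing m with
  | empty =>
    rw [Finset.prod_empty, mul_one] at hm
    subst hm
    rw [Finset.prod_empty, one_mul, DirichletCharacter.changeLevel_self]
  | insert j T hj ih =>
    -- `m = m' · ℓ_j` with `m' = m₀ ∏_{T} ℓ_i`
    haveI hm'0 : NeZero (m₀ * ∏ i ∈ T, ℓ i) :=
      ⟨mul_ne_zero (NeZero.ne m₀) (Finset.prod_ne_zero_iff.mpr fun i _ => (hℓ i).out.ne_zero)⟩
    haveI : NeZero (ℓ j) := ⟨(hℓ j).out.ne_zero⟩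
    have hm' : m = (m₀ * ∏ i ∈ T, ℓ i) * ℓ j := by rw [hm, Finset.prod_insert hj]; ring
    have hdvd' : m₀ ∣ m₀ * ∏ i ∈ T, ℓ i := dvd_mul_right _ _
    rw [sum_units_changeLevel_congr f hm' hdvd (hdvd'.trans (dvd_mul_right _ (ℓ j))) χ₀,
      DirichletCharacter.changeLevel_trans χ₀ hdvd' (dvd_mul_right _ (ℓ j))]
    -- coprimality of `ℓ_j` with `m'`
    have hcop : (ℓ j).Coprime (m₀ * ∏ i ∈ T, ℓ i) := by
      refine Nat.Coprime.mul_right (((Nat.Prime.coprime_iff_not_dvd (hℓ j).out).mpr (hm₀ j))) ?_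
      exact Nat.Coprime.prod_right fun i hi =>
        (Nat.coprime_primes (hℓ j).out (hℓ i).out).mpr fun h => hj (hinj h ▸ hi)
    rw [CharComponent.sum_changeLevel_mul_ratPlusSymbol f hf hQ (hℓ j).out (hℓN j) hcop (ha j),
      ih rfl hdvd', Finset.prod_insert hj]
    -- the new Euler factor is read at level `m₀`
    have hcopZ : IsCoprime ((ℓ j : ℕ) : ℤ) (m₀ * ∏ i ∈ T, ℓ i : ℕ) :=
      (Nat.isCoprime_iff_coprime).mpr hcop
    have h1 : DirichletCharacter.changeLevel hdvd' χ₀ ((ℓ j : ℕ) : ZMod (m₀ * ∏ i ∈ T, ℓ i)) =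
        χ₀ ((ℓ j : ℕ) : ZMod m₀) := by
      have := DirichletCharacter.changeLevel_eq_cast_of_dvd' χ₀ hdvd' hcopZ
      push_cast at this
      exact this
    have h2 : (DirichletCharacter.changeLevel hdvd' χ₀)⁻¹ ((ℓ j : ℕ) : ZMod (m₀ * ∏ i ∈ T, ℓ i)) =
        χ₀⁻¹ ((ℓ j : ℕ) : ZMod m₀) := by
      have := DirichletCharacter.changeLevel_eq_cast_of_dvd' χ₀⁻¹ hdvd' hcopZ
      push_cast at this
      rw [map_inv] at this
      exact this
    rw [h1, h2]
    ring

end Hecke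

end EulerFactorComparison

end Summit.BirchSwinnertonDyer.Rank1Residual.GaloisImage

end
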